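import Mathlib
import HarnessLib
import Summits.ABC.ABC.Theses.CongruentialReceptacle
import Summits.ABC.ABC.Theorems.ReceptacleIdentity.Negative.TameLocalReceptacleResidueFree
import Summits.ABC.ABC.Theorems.CongruentialReceptacleReceptacleIdentityStableSzpiroDefs
import Summits.ABC.ABC.Theorems.CongruentialReceptacleReceptacleIdentityStubStableSzpiroOfTLR
import Summits.ABC.ABC.Theorems.CongruentialReceptacleReceptacleIdentityStubPhiEqLinGain

/-!
# Line `stable-szpiro-duality` — decision skeleton for crux `ReceptacleIdentity` (stmt-ABC-1813)

Route `CongruentialReceptacle`; crux-plan by planner-cruxplan-stmt-ABC-1813-stable-szpiro-dualit-0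
(2026-08-16) for idea card `Cruxes/ReceptacleIdentity/Ideas/stable-szpiro-duality.md` (crux-ideate
round 2, ideator 4; triage r2-1 fail / r2-2 pass / r2-3 pass, deciding).

## What this skeleton concludes, and why it is registered against `NotTameLocalReceptacle`

The crux item stmt-ABC-1813 is INFORMAL (Disproof.lean F0: the Theses file carries it as a comment;
there is no decl `…Theses.CongruentialReceptacle.ReceptacleIdentity`), so no skeleton can conclude it
by name.  Its TYPED FACE is the rank-2 route decl `TameLocalReceptacle` (stmt-ABC-14354), and the
triage panel (r2-2, r2-3 and the synthesis of r2-1) is unanimous that the idea is a DECISION line for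
that decl under the route's kill criterion (i′): it can deliver `¬ TameLocalReceptacle`, and nothing on
the positive side short of the Target (StableSzpiro at `‖F‖₁ = 1` IS `BalancedFreySzpiro`; binding
triage note: no lead is to be seated on PROVING StableSzpiro).  The skeleton is therefore registered
(as PICKED.md did for line `Sketch`) against the line's own typed target

  `NotTameLocalReceptacle : Prop := ¬ TameLocalReceptacle`,

and `not_tameLocalReceptacle : ¬ TameLocalReceptacle` (one `exact`) is the negative edge on the route
decl that the H21 audit records by name.  When the stubs land, the lead proposes that theorem under
`Theorems/ReceptacleIdentity/Negative/` and closes stmt-ABC-14354 `--as refuted` (kill criterion (i′));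
branch (i) of the informal stmt-ABC-1813 dies with it.

## Mechanism (card §Lever, sharpened by r2-2/r2-3)

Treat the crux's table `t(p; i,j,k; r,s,z)` as a linear functional on formal sums of TAME DATA and
dualise.  `∂T := Σ_{p ∣ abc} [D_p(T)]` is the formal sum of the local classes of a triple,
`∂F := Σ_T w_T ∂T` that of a finitely supported signed family `F` of κ-balanced abc-triples, and
`Φ(μ) := Σ_d μ(d)⁺·c₁(2v−6−ε)log p − μ(d)⁻·c₁′(v+1)log p` the box minimum of `⟨μ, t⟩` over tables in
the crux's windows.  STABLE SZPIRO (`StableSzpiroAt κ ε`): `Φ(∂F) ≤ c₃‖F‖₁` for every signed family.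

* stub A1 `stub_stableSzpiroAt_of_tameLocalReceptacleAt` — the crux at `(κ, ε)` implies Stable
  Szpiro at `(κ, ε)` with the SAME constants: for a finite family take a prime `ℓ` above every `abc`
  in the support and `ℓⁿ` above `m₀` and twice the a-priori bound, read the congruences as
  equalities (`congruenceToEquality_of_two_mul_abs_lt`, landed), sum with the weights, compare with
  the box minimum termwise.  Re-derived by hand by all three triagers; the ideator's kernel-checked
  proof (evidence 20260816T133240Z-Sketch.lean) is not mounted in planner/triage jails, hence a stub.
* stub `stub_phi_eq_linGain_of_matched` — on the MATCHED cone (`∂F ≥ 0`: every class of a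
  negatively weighted triple is covered, with multiplicity, by classes of positively weighted ones)
  `Φ` is LINEAR and `c₁′`-free: `Φ(∂F) = c₁ · Σ_T w_T·s_T`, `s_T = 2 log(abc) − (6+ε) log rad(abc)`
  (r2-2 sharpen; exchange of summation plus `log n = Σ_p v_p(n) log p`, `log rad = Σ_p log p`).
* stub `stub_matchedFreeLunch` (CREATIVE, hardest, load-bearing) — at some `κ > 0`, `ε > 0` there are
  matched families of unbounded ratio: `∀ C, ∃ F matched, C·‖F‖₁ < Σ_T w_T s_T`.  Equivalently
  `sup_X s*(X) = ∞` for the LP the kit jobs measure (j017974/j018049: `s* = 1.17, 1.17, 2.68` at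
  `c ≤ 2500, 5000, 10⁴`, θ = ½-smooth, κ = ¼; ideator 5's κ-dial r*, j018013).  COMPLETENESS (line
  card §Transfer): by finite LP duality + compactness, `¬ StableSzpiroAt κ ε` already implies a
  matched free lunch at `(κ, ε)`, so restricting to matched families loses nothing and `c₁′` plays no
  role; the template must beat every ONE-SIDED real table `t ≥ lower window`.  Anatomy of any
  template (r2-3, sharpened in the line card): the gain is carried by the NET classes, which must be
  4-full (`v ≥ 4`, F4 read dually); a negatively weighted triple has no private class, so each of
  its classes — including those at its LARGE primes, where a class pins the member (knob) — must
  recur in a positive triple: negatives are smooth or member-shared; covering a class at `p` forces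
  `unit parts ≡` and `partners ≡ (mod p)`.  The minimal design is the DILATION PAIR (`‖F‖₁ = 2`)
  `T⁻ = (a,b,c)`, `T⁺ = (a·m₁, b·m₂, c·m₃)` with `m₁ ≡ m₂ ≡ m₃ ≡ 1 (mod rad(abc))`, `m_i` 4-full,
  `a m₁ + b m₂ = c m₃` (gain `σ(m₁)+σ(m₂)+σ(m₃)`, `σ(x) = 2 log x − (6+ε) log rad x`); with
  `m_i = x⁴, y⁴, z⁴` it is triage r2-1's fourth-power multiplier ansatz — formally impossible in
  degree 1, alive over `𝔽₃` by Fermat, heuristically sporadic over `ℤ`.  Two generators feed this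
  stub: the ALGEBRAIC one (sibling card formal-certificate-specialisation: a formal certificate over
  `ℤ[X]` specialises to matched families with gain `∝ log s`) and the ARITHMETIC one (LP-distilled
  prime-by-prime designs on smooth balanced triples, where every covering condition is a congruence
  to a small modulus; kit j017974/j018049/j018013 are its first data points).

Composition (kernel-checked, no sorry of its own): `notTameLocalReceptacle_of_stubs` — from the crux
get Stable Szpiro at the template's `(κ, ε)` (A1), evaluate `Φ` on the matched template by linearity,
and the ratio `C := c₃/c₁` is beaten: contradiction.  `NotTameLocalReceptacle_of` applies it to the
three stubs.

## Disproof used (Cruxes/ReceptacleIdentity/Disproof.lean, cdisprove cycle 1)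

No `_false_without_<H>` theorem exists (F0).  F4 `tameLocalReceptacle_without_lower_window`: the gain
functional has positive coefficients only on `v ≥ 4` data — built into `lowerW`, and the line card's
template anatomy (private members 4-full) is F4 read dually.  F1 (`not_tameLocalReceptacleResidueFree_of_neg`
+ landed `Theorems/ReceptacleIdentity/Negative/TameLocalReceptacleResidueFree*`, IMPORTED here so the
stub set is checked against it: no stub is an instance of the refuted residue-free statement — A1 is an
implication FROM the crux, the linearity stub an identity, the template an existence claim in the
residue-aware complex): NOT restated — our
families live in the residue-AWARE complex (data carry `r, s, z`); F1's triangle is the `‖F‖₁ = 3`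
matched free lunch of the residue-free quotient and fails here exactly at the partner congruences
(r2-3 (a)).  F2 `averaging_cannot_refute` / `knob`: honoured — no averaging; certificates are
individual signed families, binding on smooth triples; the knob progression is the free sharing move.
`ledger negatives --problem ABC`: stmt-ABC-1689, stmt-ABC-1205 — unrelated shapes; nothing refuted is
restated (StableSzpiro is implied by the OPEN crux, not by a refuted statement).

HONEST REACH: `¬ TameLocalReceptacle` (decision of stmt-ABC-14354, kill criterion (i′)).  If instead
`stub_matchedFreeLunch` is false at every `(κ, ε)`, Stable Szpiro holds over ℝ and the typed crux's
content beyond the Target is a rounding/discrepancy statement — a planner-level closure, recorded in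
the line card, not a theorem of this file.
-/

-- `Summit.<Summit>.<Problem>`: for the single-conjunct summit `ABC` the two coincide (CONVENTIONS §2).
set_option linter.dupNamespace false

namespace Summit.ABC.ABC.Cruxes.ReceptacleIdentity.StableSzpiroDuality

open Literature.NumberTheory.DiophantineGeometry (IsABCTriple rad)
open Summit.ABC.ABC.Theses.CongruentialReceptacle
open Summit.ABC.ABC.Theorems.StableSzpiro
open Finset

noncomputable section

/-! ### Vocabulary

All objects (`Datum`, `datumAt`, `boundary`, `Phi`, `SignedFamily` with `bdry`/`l1`/`linGain`/`Matched`,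
`szpiroExcess`, `TameLocalReceptacleAt`, `StableSzpiroAt`, `StableSzpiro`, `MatchedFreeLunch`,
`FreeLunchBeyondSingletons`, `NotTameLocalReceptacle`, `tameLocalReceptacle_iff`, `tripleSum_eq`,
`matchedFreeLunch_of_beyondSingletons`) are IMPORTED from the landed Defs file
`Theorems/CongruentialReceptacleReceptacleIdentityStableSzpiroDefs.lean` (p133899, commit 9ee8486abd7d; namespace
`Summit.ABC.ABC.Theorems.StableSzpiro`), verbatim the planner's skeleton definitions — reshaped by lead
prover-line-stmt-ABC-1813-a1-0 (2026-08-17) so that stub files and the closing file share one vocabulary.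
The registered prelude stub `stub_tameLocalReceptacle_iff` is proved there. -/

/-! ### Registered stubs -/

/-! **Stub A1** `stub_stableSzpiroAt_of_tameLocalReceptacleAt : ∀ κ ε, TameLocalReceptacleAt κ ε → StableSzpiroAt κ ε`
— LANDED (p134656, `Theorems/CongruentialReceptacleReceptacleIdentityStubStableSzpiroOfTLR.lean`, 193 lines), imported:
`Summit.ABC.ABC.Theorems.StableSzpiro.stub_stableSzpiroAt_of_tameLocalReceptacleAt`.

**Linearity stub** `stub_phi_eq_linGain_of_matched : ∀ κ c₁ c₁' ε (F : SignedFamily κ), F.Matched →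
Phi c₁ c₁' ε F.bdry = c₁ * F.linGain ε` — LANDED (p134795,
`Theorems/CongruentialReceptacleReceptacleIdentityStubPhiEqLinGain.lean`, 115 lines), imported:
`Summit.ABC.ABC.Theorems.StableSzpiro.stub_phi_eq_linGain_of_matched`. -/

/-- **Stub (CREATIVE — the load-bearing, hardest stub; the line lives or dies here).**  At some
balance `κ > 0` and some `ε > 0` there are residue-MATCHED signed families of κ-balanced abc-triples
with unbounded gain ratio.  WHY PLAUSIBLY TRUE: the residue-free instance is a theorem (F1, landed:
ratio `∝ log r` at `‖F‖₁ = 3`); residue-aware LP optima are matched families whose ratio grows at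
accessible heights (`1.17 → 2.68`, θ = ½, j017974; κ-dial `0.39/0.77/1.11` at `X = 200/283/400`,
κ = 1/16, j018013) beyond every singleton; the knob progression gives free residue-aware sharing at
small κ.  WHY IT MIGHT FAIL: every template must place 4-full PRIVATE members in prescribed residue
configurations (partners agree mod the radical of each shared member); small designs are then
formal-or-sporadic (triage r2-1/r2-3: char-0 formal certificates are overdetermined), and a diffuse
LP trend decides nothing — the honest end may be "no template found".  A template at ANY `(κ, ε)`
kills the decl as typed; one at `κ ≥ 1/4` also kills its `QuarterWindowGivesCrux` repair. -/
theorem stub_matchedFreeLunch :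
    ∃ κ : ℝ, 0 < κ ∧ ∃ ε : ℝ, 0 < ε ∧ MatchedFreeLunch κ ε := by
  sorry

/-! ### Composition (kernel-checked; no sorry of its own) -/

/-- **The composition, hypotheses form** (sorry-free, standard axioms): A1 + linearity on the
matched cone + a matched free-lunch template refute the typed face of the crux. [folklore] -/
theorem notTameLocalReceptacle_of_stubs
    (h₁ : ∀ κ ε : ℝ, TameLocalReceptacleAt κ ε → StableSzpiroAt κ ε)
    (h₂ : ∀ (κ c₁ c₁' ε : ℝ) (F : SignedFamily κ), F.Matched →
      Phi c₁ c₁' ε F.bdry = c₁ * F.linGain ε)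
    (h₃ : ∃ κ : ℝ, 0 < κ ∧ ∃ ε : ℝ, 0 < ε ∧ MatchedFreeLunch κ ε) :
    ¬ TameLocalReceptacle := by
  intro hT
  obtain ⟨κ, hκ, ε, hε, hFL⟩ := h₃
  obtain ⟨c₁, c₁', c₃, hc₁, hSS⟩ := h₁ κ ε (tameLocalReceptacle_iff.mp hT κ hκ ε hε)
  obtain ⟨F, hM, hlt⟩ := hFL (c₃ / c₁)
  have hle : Phi c₁ c₁' ε F.bdry ≤ c₃ * F.l1 := hSS F
  rw [h₂ κ c₁ c₁' ε F hM] at hle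
  have hmul : c₁ * (c₃ / c₁ * F.l1) < c₁ * F.linGain ε := mul_lt_mul_of_pos_left hlt hc₁
  have hc : c₁ * (c₃ / c₁ * F.l1) = c₃ * F.l1 := by
    field_simp
  linarith

/-- **Registered skeleton theorem**: concludes the line's typed target BY NAME from the three stubs. -/
theorem NotTameLocalReceptacle_of : NotTameLocalReceptacle :=
  notTameLocalReceptacle_of_stubs
    Summit.ABC.ABC.Theorems.StableSzpiro.stub_stableSzpiroAt_of_tameLocalReceptacleAt
    Summit.ABC.ABC.Theorems.StableSzpiro.stub_phi_eq_linGain_of_matched stub_matchedFreeLunch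

/-- The same, spelled as the negative edge on the route decl (what lands under
`Theorems/ReceptacleIdentity/Negative/` once the stubs are proved; kill criterion (i′)). -/
theorem not_tameLocalReceptacle : ¬ TameLocalReceptacle :=
  NotTameLocalReceptacle_of

/-- Consequently the crux's real dual fails too (the decision reading: the line refutes the typed
crux THROUGH Stable Szpiro; matched families are a complete certificate class for `¬ StableSzpiroAt`). -/
theorem not_stableSzpiro : ¬ StableSzpiro := by
  intro hSS
  obtain ⟨κ, hκ, ε, hε, hFL⟩ := stub_matchedFreeLunch
  obtain ⟨c₁, c₁', c₃, hc₁, h⟩ := hSS κ hκ ε hε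
  obtain ⟨F, hM, hlt⟩ := hFL (c₃ / c₁)
  have hle : Phi c₁ c₁' ε F.bdry ≤ c₃ * F.l1 := h F
  rw [Summit.ABC.ABC.Theorems.StableSzpiro.stub_phi_eq_linGain_of_matched κ c₁ c₁' ε F hM] at hle
  have hmul : c₁ * (c₃ / c₁ * F.l1) < c₁ * F.linGain ε := mul_lt_mul_of_pos_left hlt hc₁
  have hc : c₁ * (c₃ / c₁ * F.l1) = c₃ * F.l1 := by
    field_simp
  linarith

end

end Summit.ABC.ABC.Cruxes.ReceptacleIdentity.StableSzpiroDuality
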